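import Summits.Ventures.HodgeRepro2.HostAPI.Carriers.AlgebraicGeometry.Motives.AbelianVariety
import Mathlib.RingTheory.KrullDimension.Field

/-!
# T6A2WeilUnitAV — the trivial abelian variety (the base point) is an `AbelianVariety k`

Cell pub-hodge-repro2, Tier 6 (README §10), seat t6-p2 (A2 owner). NON-VACUITY WITNESS (README §10.5(ii)(c)) for
every quantifier `∀ A : AbelianVariety ℂ` of the cell's displays — this seat's `Hyp.LangeBirkenhake1992_Prop1_1_20 Bd`
(T6A2HypLange) and the host's own `HostAPI.HCCM.Statement` — : the base point `𝟙_ (SchemeOver k) = Spec k` with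
its trivial group law (Mathlib's `GrpObj (𝟙_ C)`) is proper (the identity), geometrically integral (every base
change along `Spec K → Spec k` is `Spec K`, a one-point reduced space) and of dimension `0`
(`PrimeSpectrum.topologicalKrullDim_eq_ringKrullDim` + `ringKrullDim_eq_zero_of_field`), so `AbelianVariety k` is
inhabited; given the point-projectivity display `Hyp.Hartshorne1977_pointProjective` (T6A2HypHost, consumed in
T6A2WeilTensor) it is moreover smooth projective of dimension `unitAV.dim = 0`, i.e. a point of the display's
domain `{(A, hA)}`. No display is consumed here; no `sorry`; standard axioms. §8(d): uses an L-value-free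
non-vanishing device: NO.
-/

noncomputable section

open CategoryTheory MonoidalCategory AlgebraicGeometry
open HostAPI.Carriers.AlgebraicGeometry.Motives

namespace Summit.Ventures.HodgeRepro2.T6.WeilUnitAV

universe u

variable (k : Type u) [Field k]

/-- `Spec K` of a field is an irreducible space (one point) -/
theorem irreducibleSpace_spec_field (K : Type u) [Field K] : IrreducibleSpace (Spec (CommRingCat.of K)) := by
  haveI : Subsingleton (Spec (CommRingCat.of K)) := inferInstanceAs (Subsingleton (PrimeSpectrum K))
  haveI : Nonempty (Spec (CommRingCat.of K)) := inferInstanceAs (Nonempty (PrimeSpectrum K))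
  exact inferInstance

/-- the base point is geometrically irreducible over itself: every base change along `Spec K → Spec k` is
`Spec K`, a one-point space -/
theorem geometricallyIrreducible_unit : GeometricallyIrreducible (𝟙_ (SchemeOver k)).hom := by
  refine ⟨fun K _ y Z fst snd h => ?_⟩
  haveI : IsIso (𝟙_ (SchemeOver k)).hom := inferInstanceAs (IsIso (𝟙 (Spec (CommRingCat.of k))))
  haveI : IsIso snd := h.isIso_snd_of_isIso
  haveI := irreducibleSpace_spec_field K
  exact (snd.homeomorph.irreducibleSpace_iff).2 inferInstance

/-- the base point is geometrically reduced over itself: every base change along `Spec K → Spec k` is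
`Spec K`, which is reduced -/
theorem geometricallyReduced_unit : GeometricallyReduced (𝟙_ (SchemeOver k)).hom := by
  refine ⟨fun K _ y Z fst snd h => ?_⟩
  haveI : IsIso (𝟙_ (SchemeOver k)).hom := inferInstanceAs (IsIso (𝟙 (Spec (CommRingCat.of k))))
  haveI : IsIso snd := h.isIso_snd_of_isIso
  exact isReduced_of_isOpenImmersion snd

/-- the base point is geometrically integral over itself -/
theorem geometricallyIntegral_unit : GeometricallyIntegral (𝟙_ (SchemeOver k)).hom :=
  haveI := geometricallyReduced_unit k
  haveI := geometricallyIrreducible_unit k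
  GeometricallyIntegral.of_geometricallyReduced_of_geometricallyIrreducible _

/-- the identity of the base point is proper -/
theorem isProper_unit : IsProper (𝟙_ (SchemeOver k)).hom :=
  MorphismProperty.id_mem @IsProper (Spec (CommRingCat.of k))

/-- **THE TRIVIAL ABELIAN VARIETY**: the base point `Spec k` with its trivial group law. -/
def unitAV : AbelianVariety k where
  X := 𝟙_ (SchemeOver k)
  grpObj := inferInstance
  isProper := isProper_unit k
  geometricallyIntegral := geometricallyIntegral_unit k

/-- `AbelianVariety k` is inhabited (the §10.5(ii)(c) witness for the quantifier `∀ A : AbelianVariety ℂ`). -/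
instance : Nonempty (AbelianVariety k) := ⟨unitAV k⟩

/-- the topological Krull dimension of `Spec K` of a field is `0` -/
theorem topologicalKrullDim_spec_field (K : Type u) [Field K] :
    topologicalKrullDim (Spec (CommRingCat.of K)) = 0 := by
  change topologicalKrullDim (PrimeSpectrum K) = 0
  rw [PrimeSpectrum.topologicalKrullDim_eq_ringKrullDim, ringKrullDim_eq_zero_of_field]

/-- the trivial abelian variety has dimension `0` -/
theorem unitAV_dim : (unitAV k).dim = 0 := by
  show schemeDim (Spec (CommRingCat.of k)) = 0
  unfold schemeDim
  rw [topologicalKrullDim_spec_field]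
  rfl

/-- **THE TRIVIAL ABELIAN VARIETY IS SMOOTH PROJECTIVE OF ITS DIMENSION `0`, given that the base point is
projective** (the clause displayed as `Hyp.Hartshorne1977_pointProjective`, T6A2HypHost): a point `(A, hA)` of the
domain of `Hyp.LangeBirkenhake1992_Prop1_1_20 Bd`. -/
theorem isSmoothProjective_unitAV (hP : IsProjectiveOver (𝟙_ (SchemeOver k))) :
    IsSmoothProjective (unitAV k).dim (unitAV k).X := by
  rw [unitAV_dim]
  exact { smoothOfRelativeDimension :=
            inferInstanceAs (SmoothOfRelativeDimension 0 (𝟙 (Spec (CommRingCat.of k))))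
          isProjectiveOver := hP
          geometricallyIrreducible := geometricallyIrreducible_unit k }

/-- projective space is projective over `k` (the identity is a closed immersion): the domain of the display
`Hyp.Hartshorne1977_productProjective` (`∀ X Y, IsProjectiveOver X → IsProjectiveOver Y → …`) is inhabited. -/
theorem isProjectiveOver_projectiveSpace (n : ℕ) : IsProjectiveOver (projectiveSpace n k) :=
  ⟨n, 𝟙 _, by rw [Over.id_left]; exact MorphismProperty.id_mem @IsClosedImmersion _⟩

end Summit.Ventures.HodgeRepro2.T6.WeilUnitAV

end
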